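import Literature.Probability.LatticeModels.LayeredPlaneRotatorDecoupling
import Literature.Probability.LatticeModels.PlaneRotatorIsingComparisonProof
import Literature.Probability.LatticeModels.IsingSusceptibilityFromDCTBox
import Literature.Probability.LatticeModels.TwistCorrBoxLimit
import Mathlib.Analysis.Complex.ExponentialBounds
import HarnessLib

/-!
# A certificate-backed layer-decoupling bound for the classical layered XY model:
# one Duminil-Copin–Tassion box (2D Ising) × Aizenman–Simon comparison × Lieb–Rivasseau decoupling

Topic `Literature/Probability/LatticeModels`. The tree's UNCONDITIONAL layer decoupling for the classical layered XY
model on finite `Λ ⊂ ℤ³` (`PlaneRotator.twoPoint_layered_le_pow_interlayer'`, `LayeredPlaneRotatorDecoupling.lean`: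
`⟨cos(θ_a − θ_c)⟩_Λ ≤ (βJ⊥ χ∥)^{|ℓ(a) − ℓ(c)|}` for ANY uniform ceiling `χ∥` on the single-layer susceptibility
`∑_{x ∈ Λ_{ℓ(a)}} ⟨cos(θ_a − θ_x)⟩^{2D}`) is made QUANTITATIVE without Monte Carlo: `χ∥` is bounded by a kernel chain
whose only external input is ONE finite computation, the Duminil-Copin–Tassion boundary functional `φ_{β'}(S₀) < 1` of
the two-dimensional nearest-neighbour Ising model in one finite box (`dctIsingPhi`, `SharpnessSubcritical.lean`).

The chain (every arrow a theorem of the tree or of this file):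

1. **Ising susceptibility from one box** (`tsum_twoPointFree_le_card_div`, file `IsingSusceptibilityFromDCTBox.lean`; the modified Simon–Lieb inequality of
   Duminil-Copin–Tassion 2016, §2.5 — PROVED in the tree, `dct_modifiedSimon_finiteVolume_holds` — summed over the tail
   with the tree's `tailSum_le_pow_mul_tsum`; B. Simon, CMP 77 (1980) 111, E. H. Lieb, CMP 77 (1980) 127; R. Panis,
   arXiv:2309.05797, Remark 3.22 `χ ≤ |S|/(1 − φ_β(S))`): `0 ∈ S₀ ⊆ Λ_K ⊂ ℤ^d`, `φ_β(S₀) < 1` ⇒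
   `∑_{x ∈ ℤ^d} ⟨σ₀σ_x⟩^∅_β ≤ (2K+1)^d/(1 − φ_β(S₀))` (summability from the tree's
   `twoPointFree_exp_decay_of_dctIsingPhi_lt_one`); monotone in `β` by GKS II (`…_of_le`), and a bound for every
   finite-volume free state by GKS volume monotonicity + translation covariance (`sum_isingTwoPoint_free_le_card_div`).
2. **One XY layer ≤ the 2D Ising model on its site set** (`twoPoint_inPlane_le_isingTwoPoint`): M. Aizenman, B. Simon,
   Phys. Lett. 76A (1980) 281, eq. (1) — a KERNEL theorem of the tree (`AizenmanSimonRotorIsingComparison_holds`): the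
   plane rotator with `K = βJ∥` per bond is dominated by the Ising model at `β' = K/2` on the same finite set; the free
   rotators/spins off the layer decouple (`PairIsing.avg_comp_eq_avg_of_vanish`), and the pair-interaction average with
   couplings `β'/2·𝟙{x ∼ y}` IS the tree's free-boundary zero-field Gibbs expectation on `ℤ²`
   (`PairIsing.avg_adj_eq_isingExpect_free`), the layer being identified with its projection `layerSites Λ k ⊂ ℤ²`
   (`layerEmb`, `layeredCoupling_snoc`).
3. **Assembly** (`sum_twoPoint_inPlane_le_card_div`, `twoPoint_layered_le_pow_of_dctIsingPhi`): for `β, J∥ > 0`,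
   `J⊥ ≥ 0`, `βJ∥/2 ≤ β₀'`, `0 ∈ S₀ ⊆ Λ_K`, `φ_{β₀'}(S₀) < 1`, all finite `Λ ⊂ ℤ³`, all `a, c ∈ Λ`:

     `⟨cos(θ_a − θ_c)⟩_{Λ,β} ≤ (β J⊥ (2K+1)²/(1 − φ_{β₀'}(S₀)))^{|ℓ(a) − ℓ(c)|}`.

4. **Two certificate rows** (`twoPoint_layered_le_pow_certificate_w23o50`, `…_w9o20`): with the box value as the ONLY
   hypothesis (`φ_{½log(50/23)}(Λ₉) ≤ 0.5098`, resp. `φ_{½log(20/9)}(Λ₁₀) ≤ 0.7079` — exact rational transfer-matrix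
   values `0.50970…` / `0.70787…` computed by the cell `pub/hubbard-tc`, kit jobs j265253 / j265254, two engines),
   decay `(3/4)^{|Δℓ|}` across the layers for every `k_BT ≥ 1.2878·J∥` when `J⊥ ≤ J∥/800`, resp. `(1/3)^{|Δℓ|}` for every
   `k_BT ≥ 1.2523·J∥` when `J⊥ ≤ J∥/4000` — the first Monte-Carlo-free ceilings on the ordering temperature of the
   layered XY model at cuprate-like anisotropies that beat the mean-field value `2J∥ + J⊥`
   (`PlaneRotatorMeanFieldBound.lean`) and Lieb's Bessel criterion `≈ 1.94·J∥` (`PlaneRotatorLiebCriterion.lean`);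
   Monte Carlo gives `T_c(J⊥/J∥ = 10⁻³) = 1.005·J∥`, `T_KT = 0.893·J∥` for scale [float, not used].

Use (cell `pub/hubbard-tc`, MO-S3 ORDER → T_c back-end, ASSUMPTIONS §1 key K4-c, route K5-I): the in-plane step of the
interlayer transfer is no longer mean-field nor Monte-Carlo: «certified 2D box value ⇒ 2D susceptibility ceiling ⇒ no
3D order above `T₀`». HONEST FRAMING: a theorem about the CLASSICAL layered XY model in finite volume; its material use
rests on the modelling key K5 (superconducting layer ↦ plane rotators with certified stiffness ceilings as couplings) —
never certified; the certificate hypothesis is a finite exact computation discharged outside the kernel (two engines,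
sha-manifested), exactly like the cell's other certificate-hypothesis rows.

Not here: an in-kernel evaluation of `φ_β(Λ_L)` (a `2^{2L+1}`-state transfer matrix — external by design); the
infinite-volume limit / a `T_c` object for rotators (none in the tree); sharper susceptibility ceilings (the `|Λ_K|`
term counts the first `K` shells at their trivial bound `1`); the lower direction (Ginibre).

Mathlib/tree anchors: `Fin.snoc`/`Fin.init` (layer projection), `Finset.sum_image`, `Summable.sum_le_tsum`,
`Real.log_two_lt_d9`, `Real.log_le_sub_one_of_pos`; tree `tailSum_le_pow_mul_tsum`, `sum_box_add_tailSum`,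
`summable_of_exp_decay`, `twoPointFree_le_dct_sum`, `isingTwoPoint_free_le_twoPointFree_sub`, `twoPointFree_mono_beta`,
`zdGraph_adj_iff_norm_holds`, `PairIsing.avg_comp_eq_avg_of_vanish`, `PairIsing.avg_adj_eq_isingExpect_free`,
`AizenmanSimonRotorIsingComparison_holds`, `twoPoint_layered_le_pow_interlayer'`.
-/

noncomputable section

open MeasureTheory Filter Finset
open scoped Topology BigOperators

namespace Literature.Probability.LatticeModels


/-! ### Part 1. One XY layer of `Λ ⊂ ℤ³` versus the 2D Ising model on its projected site set -/

namespace PlaneRotator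

section LayeredCertificate

open Literature.Barriers.CriticalPhenomena Literature.Barriers.CriticalPhenomena.LongRangeIsing

variable {Λ : Finset (Site 3)}

/-- The sites of layer `k` of `Λ ⊂ ℤ³`, projected to `ℤ²` (drop the third coordinate). [cite: LiuStanley1972, p. 272 (layers (J, J, εJ))] -/
def layerSites (Λ : Finset (Site 3)) (k : ℤ) : Finset (Site 2) :=
  (Λ.filter (fun x => x (Fin.last 2) = k)).image Fin.init

/-- A projected layer-`k` site lifts back into `Λ` at height `k`. [folklore] -/
private theorem snoc_mem_of_mem_layerSites {k : ℤ} {z : Site 2} (hz : z ∈ layerSites Λ k) :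
    (Fin.snoc z k : Site 3) ∈ Λ := by
  obtain ⟨x, hx, rfl⟩ := Finset.mem_image.1 hz
  obtain ⟨hxΛ, hx2⟩ := Finset.mem_filter.1 hx
  have : (Fin.snoc (Fin.init x) k : Site 3) = x := by rw [← hx2]; exact Fin.snoc_init_self x
  rw [this]; exact hxΛ

/-- The embedding of the projected layer `k` back into `Λ` (`z ↦ (z, k)`). [folklore] -/
def layerEmb (Λ : Finset (Site 3)) (k : ℤ) : ↥(layerSites Λ k) → ↥Λ :=
  fun z => ⟨Fin.snoc z.1 k, snoc_mem_of_mem_layerSites z.2⟩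

variable {k : ℤ}

/-- `layer x` is the last coordinate. [folklore] -/
private theorem layer_eq_apply_last (x : Λ) : layer x = (x : Site 3) (Fin.last 2) := rfl

/-- The lifted site lies in layer `k`. [folklore] -/
private theorem layer_layerEmb (z : ↥(layerSites Λ k)) : layer (layerEmb Λ k z) = k := by
  rw [layer_eq_apply_last]
  show (Fin.snoc z.1 k : Site 3) (Fin.last 2) = k
  exact Fin.snoc_last _ _

/-- Projecting the lifted site gives back the projected site. [folklore] -/
private theorem init_layerEmb (z : ↥(layerSites Λ k)) : Fin.init ((layerEmb Λ k z : Λ) : Site 3) = z.1 :=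
  Fin.init_snoc _ _

/-- The layer embedding is injective. [folklore] -/
private theorem layerEmb_injective : Function.Injective (layerEmb Λ k) := by
  intro z w h
  apply Subtype.ext
  have := congrArg (fun x : Λ => Fin.init (x : Site 3)) h
  simpa only [init_layerEmb] using this

/-- A site of layer `k` projects into `layerSites Λ k`. [folklore] -/
private theorem init_mem_layerSites {x : Λ} (hx : layer x = k) : Fin.init (x : Site 3) ∈ layerSites Λ k :=
  Finset.mem_image.2 ⟨x, Finset.mem_filter.2 ⟨x.2, hx⟩, rfl⟩

/-- Lifting the projection of a layer-`k` site gives the site back. [folklore] -/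
private theorem layerEmb_init {x : Λ} (hx : layer x = k) : layerEmb Λ k ⟨Fin.init (x : Site 3), init_mem_layerSites hx⟩ = x := by
  apply Subtype.ext
  show (Fin.snoc (Fin.init (x : Site 3)) k : Site 3) = x
  rw [← hx, layer_eq_apply_last]
  exact Fin.snoc_init_self _

/-- The range of the layer embedding is exactly layer `k`. [folklore] -/
private theorem mem_range_layerEmb_iff {x : Λ} : x ∈ Set.range (layerEmb Λ k) ↔ layer x = k := by
  constructor
  · rintro ⟨z, rfl⟩; exact layer_layerEmb z
  · intro hx; exact ⟨_, layerEmb_init hx⟩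

/-- Layer `k` of `Λ`, as a finset of `Λ`, is the image of the layer embedding. [folklore] -/
private theorem filter_layer_eq_image_layerEmb (k : ℤ) :
    univ.filter (fun x : Λ => layer x = k) = univ.image (layerEmb Λ k) := by
  ext x
  simp only [Finset.mem_filter, Finset.mem_univ, true_and, Finset.mem_image]
  constructor
  · intro hx; exact ⟨_, layerEmb_init hx⟩
  · rintro ⟨z, rfl⟩; exact layer_layerEmb z

/-- The `ℓ¹` norm of `ℤ^d` as an integer sum of absolute values. [folklore] -/
private theorem natCast_l1Norm {d : ℕ} (v : Site d) : ((l1Norm v : ℕ) : ℤ) = ∑ i, |v i| := by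
  simp only [l1Norm, Nat.cast_sum, Int.natCast_natAbs]

/-- **In-plane couplings of one layer are the nearest-neighbour couplings of `ℤ²`**: for two sites at the same height
`k`, the layered coupling is `J∥` if their projections are adjacent in `ℤ²` and `0` otherwise.
[cite: LiuStanley1972, p. 272 (layers (J, J, εJ))] -/
theorem layeredCoupling_snoc (Jp Jz : ℝ) (k : ℤ) (i j : Site 2) :
    layeredCoupling Jp Jz (Fin.snoc i k) (Fin.snoc j k) = if (zdGraph 2).Adj i j then Jp else 0 := by
  have hsub : (Fin.snoc i k : Site 3) - Fin.snoc j k = Fin.snoc (i - j) 0 := by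
    funext t
    refine Fin.lastCases ?_ (fun t => ?_) t
    · simp only [Pi.sub_apply, Fin.snoc_last, sub_self]
    · simp only [Pi.sub_apply, Fin.snoc_castSucc]
  have hl1 : l1Norm (Fin.snoc (i - j) 0 : Site 3) = l1Norm (i - j) := by
    unfold l1Norm
    rw [Fin.sum_univ_castSucc]
    simp only [Fin.snoc_castSucc, Fin.snoc_last, Int.natAbs_zero, add_zero]
  have hadj : (zdGraph 2).Adj i j ↔ l1Norm (i - j) = 1 := by
    rw [zdGraph_adj_iff_norm_holds i j]
    have h := natCast_l1Norm (i - j)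
    simp only [Pi.sub_apply] at h
    rw [← h]
    norm_cast
  have h2 : (Fin.snoc (i - j) (0 : ℤ) : Site 3) 2 = 0 := by
    show (Fin.snoc (i - j) (0 : ℤ) : Site 3) (Fin.last 2) = 0
    exact Fin.snoc_last _ _
  unfold layeredCoupling
  rw [hsub, hl1]
  simp only [h2, hadj, if_true]

variable {β Jp Jz : ℝ}
variable [MeasurableSpace Circle] [BorelSpace Circle]

/-- **One XY layer is dominated by the 2D Ising model on its site set** (Aizenman–Simon 1980 eq. (1), a KERNEL
theorem of the tree, + decoupling of the free rotators/spins off the layer): for `u, v` in layer `k` of `Λ`,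
`⟨cos(θ_u − θ_v)⟩^{XY}_{in-plane bonds of layer k, βJ∥ per bond} ≤ ⟨σ_{π u} σ_{π v}⟩^{Ising, ∅}_{π(Λ_k); βJ∥/2, 0}`,
where `π` drops the third coordinate and the right side is the free-boundary zero-field nearest-neighbour Ising
two-point function of the tree (`isingTwoPoint (zdGraph 2)`) in the finite volume `π(Λ_k) ⊂ ℤ²` at inverse
temperature `βJ∥/2`. [cite: AizenmanSimon1980RotorIsing, eq. (1)] -/
theorem twoPoint_inPlane_le_isingTwoPoint (hβ : 0 ≤ β) (hp : 0 ≤ Jp) (hz : 0 ≤ Jz) (Λ : Finset (Site 3))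
    {k : ℤ} (u v : Λ) (hu : layer u = k) (hv : layer v = k) :
    twoPoint (inPlane (layeredXYCoupling β Jp Jz Λ) k) u v ≤
      isingTwoPoint (zdGraph 2) (layerSites Λ k) (β * Jp / 2) 0 .free (Fin.init (u : Site 3)) (Fin.init (v : Site 3)) := by
  classical
  set J := layeredXYCoupling β Jp Jz Λ with hJ
  have hJ0 : ∀ p, 0 ≤ J p := layeredXYCoupling_nonneg hβ hp hz Λ
  set c : Λ → Λ → ℝ := fun x y => inPlane J k (x, y) / 2 with hc
  have hin0 : ∀ p, 0 ≤ inPlane J k p := fun p => by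
    unfold inPlane; split_ifs; exacts [hJ0 p, le_rfl]
  have hc0 : ∀ x y, 0 ≤ c x y := fun x y => div_nonneg (hin0 _) (by norm_num)
  have h2c : (fun p : Λ × Λ => 2 * c p.1 p.2) = inPlane J k := by
    funext p; simp only [hc]; ring
  have hAS := AizenmanSimonRotorIsingComparison_holds Λ c hc0 u v
  rw [h2c] at hAS
  refine hAS.trans (le_of_eq ?_)
  -- restrict to the layer and identify with the graph Ising model on the projected layer
  set e := layerEmb Λ k with he
  set u' : ↥(layerSites Λ k) := ⟨Fin.init (u : Site 3), init_mem_layerSites hu⟩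
  set v' : ↥(layerSites Λ k) := ⟨Fin.init (v : Site 3), init_mem_layerSites hv⟩
  have heu : e u' = u := layerEmb_init hu
  have hev : e v' = v := layerEmb_init hv
  have hvanish : ∀ a b : Λ, (a ∉ Set.range e ∨ b ∉ Set.range e) → c a b = 0 := by
    intro a b hab
    simp only [he, mem_range_layerEmb_iff] at hab
    simp only [hc, inPlane]
    rw [if_neg (by tauto), zero_div]
  have hpull : (fun i j : ↥(layerSites Λ k) => c (e i) (e j)) =
      fun i j : ↥(layerSites Λ k) => if (zdGraph 2).Adj (i : Site 2) (j : Site 2) then (β * Jp / 2) / 2 else 0 := by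
    funext i j
    have hi := layer_layerEmb (Λ := Λ) (k := k) i
    have hj := layer_layerEmb (Λ := Λ) (k := k) j
    simp only [hc, inPlane, he] at hi hj ⊢
    rw [if_pos ⟨hi, hj⟩, hJ]
    simp only [layeredXYCoupling, layerEmb, layeredCoupling_snoc]
    split_ifs <;> ring
  calc PairIsing.avg c (spinPair u v) = PairIsing.avg c (fun s => spinPair u' v' (s ∘ e)) := by
        rw [← heu, ← hev]; rfl
    _ = PairIsing.avg (fun i j => c (e i) (e j)) (spinPair u' v') :=
        PairIsing.avg_comp_eq_avg_of_vanish layerEmb_injective hvanish _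
    _ = PairIsing.avg (fun i j : ↥(layerSites Λ k) =>
          if (zdGraph 2).Adj (i : Site 2) (j : Site 2) then (β * Jp / 2) / 2 else 0) (spinPair u' v') := by
        rw [hpull]
    _ = isingExpect (zdGraph 2) (layerSites Λ k) (β * Jp / 2) 0 .free
          (fun σ => spinPair u' v' (fun a => σ a)) :=
        PairIsing.avg_adj_eq_isingExpect_free (zdGraph 2) (layerSites Λ k) (β * Jp / 2) _
    _ = isingTwoPoint (zdGraph 2) (layerSites Λ k) (β * Jp / 2) 0 .free u'.1 v'.1 := rfl

/-- **Single-layer susceptibility of the layered XY model from one DCT box** (Aizenman–Simon × GKS volume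
monotonicity × the summed modified Simon–Lieb inequality): for `β, J∥ > 0`, `J⊥ ≥ 0`, every finite `Λ ⊂ ℤ³`, every
`a ∈ Λ`, and every certificate `φ_{β₀'}(S₀) < 1` (`0 ∈ S₀ ⊆ Λ_K ⊂ ℤ²`) at an Ising coupling `β₀' ≥ βJ∥/2`,
`∑_{x ∈ Λ_{ℓ(a)}} ⟨cos(θ_a − θ_x)⟩^{2D}_{Λ_{ℓ(a)}} ≤ (2K+1)²/(1 − φ_{β₀'}(S₀))` — hypothesis `hχ` of
`twoPoint_layered_le_pow_interlayer'` with an explicit, certificate-backed `χ`.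
[cite: AizenmanSimon1980RotorIsing, eq. (1)] [cite: Panis2023Triviality, Rem. 3.22] -/
theorem sum_twoPoint_inPlane_le_card_div (hβ : 0 < β) (hp : 0 < Jp) (hz : 0 ≤ Jz) (Λ : Finset (Site 3))
    {β₀' : ℝ} (hβ' : β * Jp / 2 ≤ β₀') {S₀ : Finset (Site 2)} (h0 : (0 : Site 2) ∈ S₀) {K : ℕ}
    (hSK : S₀ ⊆ box 2 K) (hφ : dctIsingPhi 2 β₀' S₀ < 1) (a : Λ) :
    ∑ x ∈ univ.filter (fun x : Λ => layer x = layer a),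
        twoPoint (inPlane (layeredXYCoupling β Jp Jz Λ) (layer a)) a x ≤
      (2 * K + 1 : ℝ) ^ 2 / (1 - dctIsingPhi 2 β₀' S₀) := by
  classical
  set k := layer a with hk
  have hβ'' : 0 < β * Jp / 2 := by positivity
  rw [filter_layer_eq_image_layerEmb k, Finset.sum_image fun z _ w _ h => layerEmb_injective h]
  calc ∑ z : ↥(layerSites Λ k), twoPoint (inPlane (layeredXYCoupling β Jp Jz Λ) k) a (layerEmb Λ k z)
      ≤ ∑ z : ↥(layerSites Λ k), isingTwoPoint (zdGraph 2) (layerSites Λ k) (β * Jp / 2) 0 .free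
          (Fin.init (a : Site 3)) z.1 := by
        refine Finset.sum_le_sum fun z _ => ?_
        have h := twoPoint_inPlane_le_isingTwoPoint hβ.le hp.le hz Λ a (layerEmb Λ k z) rfl (layer_layerEmb z)
        rwa [init_layerEmb] at h
    _ = ∑ v ∈ layerSites Λ k, isingTwoPoint (zdGraph 2) (layerSites Λ k) (β * Jp / 2) 0 .free
          (Fin.init (a : Site 3)) v :=
        Finset.sum_coe_sort (layerSites Λ k) (fun v => isingTwoPoint (zdGraph 2) (layerSites Λ k) (β * Jp / 2) 0 .free
          (Fin.init (a : Site 3)) v)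
    _ ≤ (2 * K + 1 : ℝ) ^ 2 / (1 - dctIsingPhi 2 β₀' S₀) :=
        sum_isingTwoPoint_free_le_card_div hβ'' hβ' h0 hSK hφ (layerSites Λ k) (init_mem_layerSites rfl)

/-! ### Part 2. The certificate-backed layer decoupling -/

/-- **Layer decoupling of the classical layered XY model from ONE 2D Ising box certificate** — kernel end to end
(Lieb–Rivasseau decoupling `twoPoint_layered_le_pow_interlayer'`, Aizenman–Simon comparison, GKS, and the
Duminil-Copin–Tassion finite-box criterion), the only external input being the hypothesis `φ_{β₀'}(S₀) < 1`, a finite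
computation: for `β, J∥ > 0`, `J⊥ ≥ 0`, `βJ∥/2 ≤ β₀'`, `0 ∈ S₀ ⊆ Λ_K ⊂ ℤ²`, every finite `Λ ⊂ ℤ³` and all `a, c ∈ Λ`,

  `⟨cos(θ_a − θ_c)⟩_{Λ,β} ≤ (β J⊥ · (2K+1)²/(1 − φ_{β₀'}(S₀)))^{|ℓ(a) − ℓ(c)|}`.

Reading (cell `pub/hubbard-tc`, key K4-c / route K5-I): whenever `βJ⊥(2K+1)² < 1 − φ_{βJ∥/2}(S₀)` the layered model at
inverse temperature `β` has exponential decay ACROSS the layers uniformly in the volume — no three-dimensional order at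
`k_BT = 1/β` — with NO Monte-Carlo input and no mean-field step in the planes. Classical effective model only; its use
for a material rests on the modelling key K5. [cite: Lieb1980, eq. (23) and notes added in proof (2)]
[cite: AizenmanSimon1980RotorIsing, eq. (1)] [cite: DuminilCopinTassionCMP2016, §2.5 (arXiv:1502.03050 numbering)] -/
theorem twoPoint_layered_le_pow_of_dctIsingPhi (hβ : 0 < β) (hp : 0 < Jp) (hz : 0 ≤ Jz) (Λ : Finset (Site 3))
    {β₀' : ℝ} (hβ' : β * Jp / 2 ≤ β₀') {S₀ : Finset (Site 2)} (h0 : (0 : Site 2) ∈ S₀) {K : ℕ}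
    (hSK : S₀ ⊆ box 2 K) (hφ : dctIsingPhi 2 β₀' S₀ < 1) (a c : Λ) :
    twoPoint (layeredXYCoupling β Jp Jz Λ) a c ≤
      (β * Jz * ((2 * K + 1 : ℝ) ^ 2 / (1 - dctIsingPhi 2 β₀' S₀))) ^ (layer a - layer c).natAbs :=
  twoPoint_layered_le_pow_interlayer' hβ.le hp.le hz Λ
    (fun a => sum_twoPoint_inPlane_le_card_div hβ hp hz Λ hβ' h0 hSK hφ a) a c

/-- The same with the box value replaced by any UPPER BOUND `φ̄ < 1` for it (the form in which a certified enclosure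
`φ_{β₀'}(S₀) ≤ φ̄` is consumed): `⟨cos(θ_a − θ_c)⟩_{Λ,β} ≤ (β J⊥ (2K+1)²/(1 − φ̄))^{|ℓ(a) − ℓ(c)|}`.
[cite: Lieb1980, eq. (23) and notes added in proof (2)] [cite: DuminilCopinTassionCMP2016, §2.5 (arXiv:1502.03050 numbering)] -/
theorem twoPoint_layered_le_pow_of_dctIsingPhi_le (hβ : 0 < β) (hp : 0 < Jp) (hz : 0 ≤ Jz) (Λ : Finset (Site 3))
    {β₀' : ℝ} (hβ' : β * Jp / 2 ≤ β₀') {S₀ : Finset (Site 2)} (h0 : (0 : Site 2) ∈ S₀) {K : ℕ}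
    (hSK : S₀ ⊆ box 2 K) {φb : ℝ} (hcert : dctIsingPhi 2 β₀' S₀ ≤ φb) (hφb : φb < 1) (a c : Λ) :
    twoPoint (layeredXYCoupling β Jp Jz Λ) a c ≤
      (β * Jz * ((2 * K + 1 : ℝ) ^ 2 / (1 - φb))) ^ (layer a - layer c).natAbs := by
  have hφ1 : dctIsingPhi 2 β₀' S₀ < 1 := hcert.trans_lt hφb
  refine (twoPoint_layered_le_pow_of_dctIsingPhi hβ hp hz Λ hβ' h0 hSK hφ1 a c).trans (pow_le_pow_left₀ ?_ ?_ _)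
  · exact mul_nonneg (mul_nonneg hβ.le hz) (div_nonneg (by positivity) (sub_pos.2 hφ1).le)
  · refine mul_le_mul_of_nonneg_left ?_ (mul_nonneg hβ.le hz)
    exact div_le_div_of_nonneg_left (by positivity) (sub_pos.2 hφb) (by linarith)

/-! ### Part 3. Two certificate rows (the certificate is the ONLY hypothesis; exact values from kit jobs j265253 / j265254) -/

omit [MeasurableSpace Circle] [BorelSpace Circle] in
/-- `log(50/23) ≤ 0.7802` (`= log 2 + log(25/23) ≤ 0.6931471808 + 2/23`). [folklore] -/
private theorem log_fifty_div_twentyThree_le : Real.log (50 / 23) ≤ 7802 / 10000 := by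
  have h : Real.log (50 / 23) = Real.log 2 + Real.log (25 / 23) := by
    rw [← Real.log_mul (by norm_num) (by norm_num)]; norm_num
  rw [h]
  have h2 := Real.log_two_lt_d9
  have h3 := Real.log_le_sub_one_of_pos (show (0 : ℝ) < 25 / 23 by norm_num)
  linarith

omit [MeasurableSpace Circle] [BorelSpace Circle] in
/-- `log(20/9) ≤ 0.8043` (`= log 2 + log(10/9) ≤ 0.6931471808 + 1/9`). [folklore] -/
private theorem log_twenty_div_nine_le : Real.log (20 / 9) ≤ 8043 / 10000 := by
  have h : Real.log (20 / 9) = Real.log 2 + Real.log (10 / 9) := by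
    rw [← Real.log_mul (by norm_num) (by norm_num)]; norm_num
  rw [h]
  have h2 := Real.log_two_lt_d9
  have h3 := Real.log_le_sub_one_of_pos (show (0 : ℝ) < 10 / 9 by norm_num)
  linarith

/-- **Certificate row A (LSCO-class anisotropy, `J⊥ ≤ J∥/800`).** GRANTING the finite computation
`φ_{β₀'}(Λ₉) ≤ 0.5098` for the 2D nearest-neighbour Ising model at `β₀' = ½ log(50/23) = 0.38826…`
(`e^{−2β₀'} = 23/50`; exact rational transfer-matrix value `0.50970005…`, kit job j265253, cell `pub/hubbard-tc`
`tools/dct_phi_ising2d.py`): for the classical layered XY model with `0 < J∥`, `0 ≤ J⊥ ≤ J∥/800` and every inverse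
temperature `β > 0` with `βJ∥ ≤ log(50/23) = 0.7765…` — i.e. every temperature `k_BT ≥ 1.2878·J∥` — the two-point
function decays across the layers at least like `(3/4)^{|ℓ(a) − ℓ(c)|}`, in every finite volume: NO three-dimensional
order at or above `1.2878·J∥` for any such `J⊥` (layered-XY `T_c(J⊥/J∥ = 10⁻³) = 1.005·J∥` by Monte Carlo, for scale;
mean field `2J∥ + J⊥`). Arithmetic: `βJ⊥ · 19²/(1 − 0.5098) ≤ (0.7802/800)·736.5 ≤ 3/4`. Certified-computation class:
the hypothesis is discharged outside the kernel by exact rational arithmetic (two engines), never inside.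
[cite: DuminilCopinTassionCMP2016, §2.5 (arXiv:1502.03050 numbering)] [cite: Lieb1980, eq. (23) and notes added in proof (2)] -/
theorem twoPoint_layered_le_pow_certificate_w23o50
    (hcert : dctIsingPhi 2 (Real.log (50 / 23) / 2) (box 2 9) ≤ 5098 / 10000)
    (hp : 0 < Jp) (hz : 0 ≤ Jz) (hΔ : Jz ≤ Jp / 800) (hβ : 0 < β) (hβJ : β * Jp ≤ Real.log (50 / 23))
    (Λ : Finset (Site 3)) (a c : Λ) :
    twoPoint (layeredXYCoupling β Jp Jz Λ) a c ≤ (3 / 4 : ℝ) ^ (layer a - layer c).natAbs := by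
  have hφ1 : dctIsingPhi 2 (Real.log (50 / 23) / 2) (box 2 9) < 1 := hcert.trans_lt (by norm_num)
  have hβ' : β * Jp / 2 ≤ Real.log (50 / 23) / 2 := by linarith
  have h := twoPoint_layered_le_pow_of_dctIsingPhi hβ hp hz Λ hβ' (zero_mem_box 2 9) (subset_refl _) hφ1 a c
  refine h.trans (pow_le_pow_left₀ ?_ ?_ _)
  · exact mul_nonneg (mul_nonneg hβ.le hz) (div_nonneg (by norm_num) (sub_pos.2 hφ1).le)
  · have hX : (2 * (9 : ℕ) + 1 : ℝ) ^ 2 / (1 - dctIsingPhi 2 (Real.log (50 / 23) / 2) (box 2 9)) ≤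
        361 / (1 - 5098 / 10000) := by
      have e : (2 * (9 : ℕ) + 1 : ℝ) ^ 2 = 361 := by norm_num
      rw [e]
      exact div_le_div_of_nonneg_left (by norm_num) (by norm_num) (by linarith)
    have hJz : β * Jz ≤ 7802 / 10000 / 800 := by
      have h1 : β * Jz ≤ β * Jp / 800 := by
        have := mul_le_mul_of_nonneg_left hΔ hβ.le
        linarith
      linarith [log_fifty_div_twentyThree_le]
    calc β * Jz * ((2 * (9 : ℕ) + 1 : ℝ) ^ 2 / (1 - dctIsingPhi 2 (Real.log (50 / 23) / 2) (box 2 9)))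
        ≤ (7802 / 10000 / 800) * (361 / (1 - 5098 / 10000)) :=
          mul_le_mul hJz hX (div_nonneg (by norm_num) (sub_pos.2 hφ1).le) (by norm_num)
      _ ≤ 3 / 4 := by norm_num

/-- **Certificate row B (Hg-1201-class anisotropy, `J⊥ ≤ J∥/4000`).** GRANTING `φ_{β₀'}(Λ₁₀) ≤ 0.7079` at
`β₀' = ½ log(20/9) = 0.39925…` (`e^{−2β₀'} = 9/20`; exact value `0.70786935…`, kit job j265254): for `0 < J∥`,
`0 ≤ J⊥ ≤ J∥/4000` and every `β > 0` with `βJ∥ ≤ log(20/9) = 0.7985…` — every `k_BT ≥ 1.2523·J∥` — decay across the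
layers at least like `(1/3)^{|ℓ(a) − ℓ(c)|}` in every finite volume. Arithmetic:
`βJ⊥ · 21²/(1 − 0.7079) ≤ (0.8043/4000)·1509.8 ≤ 1/3`. Certified-computation class as row A.
[cite: DuminilCopinTassionCMP2016, §2.5 (arXiv:1502.03050 numbering)] [cite: Lieb1980, eq. (23) and notes added in proof (2)] -/
theorem twoPoint_layered_le_pow_certificate_w9o20
    (hcert : dctIsingPhi 2 (Real.log (20 / 9) / 2) (box 2 10) ≤ 7079 / 10000)
    (hp : 0 < Jp) (hz : 0 ≤ Jz) (hΔ : Jz ≤ Jp / 4000) (hβ : 0 < β) (hβJ : β * Jp ≤ Real.log (20 / 9))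
    (Λ : Finset (Site 3)) (a c : Λ) :
    twoPoint (layeredXYCoupling β Jp Jz Λ) a c ≤ (1 / 3 : ℝ) ^ (layer a - layer c).natAbs := by
  have hφ1 : dctIsingPhi 2 (Real.log (20 / 9) / 2) (box 2 10) < 1 := hcert.trans_lt (by norm_num)
  have hβ' : β * Jp / 2 ≤ Real.log (20 / 9) / 2 := by linarith
  have h := twoPoint_layered_le_pow_of_dctIsingPhi hβ hp hz Λ hβ' (zero_mem_box 2 10) (subset_refl _) hφ1 a c
  refine h.trans (pow_le_pow_left₀ ?_ ?_ _)
  · exact mul_nonneg (mul_nonneg hβ.le hz) (div_nonneg (by norm_num) (sub_pos.2 hφ1).le)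
  · have hX : (2 * (10 : ℕ) + 1 : ℝ) ^ 2 / (1 - dctIsingPhi 2 (Real.log (20 / 9) / 2) (box 2 10)) ≤
        441 / (1 - 7079 / 10000) := by
      have e : (2 * (10 : ℕ) + 1 : ℝ) ^ 2 = 441 := by norm_num
      rw [e]
      exact div_le_div_of_nonneg_left (by norm_num) (by norm_num) (by linarith)
    have hJz : β * Jz ≤ 8043 / 10000 / 4000 := by
      have h1 : β * Jz ≤ β * Jp / 4000 := by
        have := mul_le_mul_of_nonneg_left hΔ hβ.le
        linarith
      linarith [log_twenty_div_nine_le]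
    calc β * Jz * ((2 * (10 : ℕ) + 1 : ℝ) ^ 2 / (1 - dctIsingPhi 2 (Real.log (20 / 9) / 2) (box 2 10)))
        ≤ (8043 / 10000 / 4000) * (441 / (1 - 7079 / 10000)) :=
          mul_le_mul hJz hX (div_nonneg (by norm_num) (sub_pos.2 hφ1).le) (by norm_num)
      _ ≤ 1 / 3 := by norm_num

end LayeredCertificate

end PlaneRotator

end Literature.Probability.LatticeModels

end
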